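import Literature.Probability.LatticeModels.LebowitzCoexistence
import Literature.Probability.LatticeModels.GibbsStatesProofs
import HarnessLib

/-!
# Lebowitz 1977, Remark (iii): continuity of the spontaneous magnetisation in `β` forces the free and plus energies to agree, hence translation invariant states are mixtures

Topic `Probability/LatticeModels`, namespace `Literature.Probability.LatticeModels`. Theorem-only
file (no definitions, no named facts), companion of `LebowitzCoexistence.lean`. There the named
fact `bodineau_translationInvariant` (`GibbsStates.lean`; T. Bodineau, PTRF 135 (2006): for
`d ≥ 3`, `β > β_c(d)`, every translation invariant `μ ∈ 𝒢(β,0)` is a mixture of `μ⁺` and `μ⁻`)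
was reduced to the identity `⟨σ_0σ_{eᵢ}⟩^∅_β = ⟨σ_0σ_{eᵢ}⟩⁺_β` (differentiability of the pressure
in `β`). This file proves the form of Lebowitz' criterion that Bodineau actually invokes —

* T. Bodineau, *Translation invariant Gibbs states for the Ising model*, PTRF 135 (2006),
  §2.3, p. 156: "Lebowitz proved in [Leb1] (Theorem 3 and remark (iii) page 472) that the
  continuity of the average magnetization implies the existence of only two extremal invariant
  states, i.e. that for `β > β_c` all the translation invariant Gibbs states are of the form
  `λμ⁺_β + (1-λ)μ⁻_β`"; §1, p. 154: "the non differentiability of the pressure has other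
  implications, namely that for any inverse temperature in `𝓑`, the average magnetization
  would be discontinuous";
* S. Friedli, Y. Velenik, *Statistical Mechanics of Lattice Systems* (CUP 2017), note [11] to
  p. 335: "continuity of the magnetization implies differentiability of the pressure with
  respect to `β` [218]" (`[218]` = Lebowitz 1977);
* J. L. Lebowitz, *Coexistence of phases in Ising ferromagnets*, J. Stat. Phys. 16 (1977)
  463–476, Thm. 3 and Remark (iii), p. 472 —

namely: **if `β ↦ m*(β)` is continuous from the left at `β > 0`, then
`⟨σ_0σ_{eᵢ}⟩^∅_{β,0} = ⟨σ_0σ_{eᵢ}⟩⁺_{β,0}` for every direction `i`**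
(`nn_freeCorr_eq_plusCorr_of_leftContinuous_magnetization`), and consequently every translation
invariant Gibbs state at `β > β_c(d)` is a mixture of `μ⁺` and `μ⁻`
(`translationInvariant_eq_mixture_of_leftContinuous_magnetization`,
`bodineau_translationInvariant_of_leftContinuous_magnetization`). After this file the one input of
`bodineau_translationInvariant` missing from the tree is literally the continuity of the
spontaneous magnetisation on `(β_c(d), ∞)` for `d ≥ 3` (Bodineau 2006, §1–§2.3 via Thm. 2.1;
Raoufi, Ann. Probab. 48 (2020), Cor. 1); right-continuity is classical and in the tree
(`plusCorr_rightContinuous_holds`), left-continuity above `β_c` in `d ≥ 3` is the deep part.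

## The proof (FKG, after Friedli–Velenik 2017, Exercise 3.10 and the proof of Thm. 3.28)

The local observable `g = σ_x + σ_y - σ_xσ_y = 4(n_x + n_y - n_xn_y) - 3` is nondecreasing
(`monotone_spinAt_add_sub_mul`; F–V Exercise 3.10), so for every Gibbs measure `ν ∈ 𝒢(β',0)` and
every finite `Λ`, `ν(g) ≤ μ⁺_{Λ;β'}(g)` (the tree's DLR–FKG sandwich
`integral_le_isingExpect_plus_of_isGibbsMeasure`, F–V proof of Lemma 6.65). For `ν = μ⁺_{β'}`:

  `2 m*(β') - ⟨σ_0σ_e⟩⁺_{β'} ≤ ⟨σ_0⟩⁺_{Λ;β'} + ⟨σ_e⟩⁺_{Λ;β'} - ⟨σ_0σ_e⟩⁺_{Λ;β'}`   (`e = eᵢ`).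

Summing over `i` and using the chord inequality of the convex pressure,
`∑ᵢ ⟨σ_0σ_{eᵢ}⟩⁺_{β'} ≤ ∑ᵢ ⟨σ_0σ_{eᵢ}⟩^∅_β` for `β' < β` (`sum_plusCorr_nn_le_sum_freeCorr_nn`,
`SharpnessLROProofs.lean`), gives `2d m*(β') - R_Λ(β') ≤ ∑ᵢ ⟨σ_0σ_{eᵢ}⟩^∅_β` with `R_Λ`
continuous in `β'` (finite volume). Letting `β' ↑ β` (left-continuity of `m*`) and then
`Λ ↑ ℤ^d` (`R_Λ(β) → 2d m*(β) - ∑ᵢ ⟨σ_0σ_{eᵢ}⟩⁺_β`) yields `∑ᵢ ⟨σ_0σ_{eᵢ}⟩⁺_β ≤ ∑ᵢ ⟨σ_0σ_{eᵢ}⟩^∅_β`,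
and `⟨·⟩^∅ ≤ ⟨·⟩⁺` termwise. (The converse fails in general: for the `1/r²` chain the pressure
is differentiable at `β_c` while `m*` jumps — Raoufi 2020, p. 3 — so only this direction is stated.)

## Mathlib status

No Gibbs measures in Mathlib. Anchors: `ContinuousWithinAt`, `nhdsWithin`, `Ioo_mem_nhdsLT`,
`le_of_tendsto`, `tendsto_finsetSum`, `Finset.prod_pair`; tree:
`integral_le_isingExpect_plus_of_isGibbsMeasure` (`GibbsStatesProofs`), `exists_plusMeasure_holds`,
`tendsto_isingCorr_plus_box` (`PlusMinusStateGibbs`), `plusCorr_singleton_eq_spontaneousMagnetization`,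
`continuous_isingCorr_beta`, `sum_plusCorr_nn_le_sum_freeCorr_nn`, `freeCorr_le_plusCorr`,
`translationInvariant_eq_mixture_of_nn_freeCorr_eq_plusCorr`,
`bodineau_translationInvariant_of_nn_freeCorr_eq_plusCorr` (`LebowitzCoexistence`).

## References

* J. L. Lebowitz, J. Stat. Phys. 16 (1977) 463–476, §3, Thm. 3 and Remark (iii), p. 472
  [Lebowitz1977].
* T. Bodineau, Probab. Theory Related Fields 135 (2006) 153–168, §1 (p. 154) and §2.3 (p. 156)
  [Bodineau2006].
* S. Friedli, Y. Velenik, *Statistical Mechanics of Lattice Systems*, CUP 2017, Exercise 3.10,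
  Thm. 3.28 (proof), Lemma 6.65 (proof), note [11] to p. 335 [FriedliVelenik2017].
* A. Raoufi, Ann. Probab. 48 (2020) 760–777 (arXiv:1710.07608), Cor. 1 and p. 3.
-/

noncomputable section

open MeasureTheory Filter Topology Finset
open scoped ENNReal

namespace Literature.Probability.LatticeModels

/-! ### The FKG observable `σ_x + σ_y - σ_xσ_y` -/

section Observable

variable {V : Type*}

/-- **`σ_x + σ_y - σ_xσ_y` is nondecreasing** (it equals `4(n_x + n_y - n_xn_y) - 3` with
`n_z = (1+σ_z)/2`, and `∑_{i∈A} n_i - n_A` is nondecreasing: Friedli–Velenik 2017, Exercise 3.10,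
the observable of the proof of Thm. 3.28). Proof: for `u ≤ u'`, `v ≤ v'` in `[-1,1]`,
`(u'+v'-u'v') - (u+v-uv) = (u'-u)(1-v') + (v'-v)(1-u) ≥ 0`. [cite: FriedliVelenik2017, Exercise 3.10, p. 110] -/
theorem monotone_spinAt_add_sub_mul (x y : V) :
    Monotone fun σ : SpinConfig V => spinAt x σ + spinAt y σ - spinAt x σ * spinAt y σ := by
  intro σ τ hστ
  have hx : spinAt x σ ≤ spinAt x τ := spinAt_mono x hστ
  have hy : spinAt y σ ≤ spinAt y τ := spinAt_mono y hστ
  have hx1 : spinAt x σ ≤ 1 := (abs_le.1 (abs_spinAt x σ).le).2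
  have hy1 : spinAt y τ ≤ 1 := (abs_le.1 (abs_spinAt y τ).le).2
  dsimp only
  nlinarith [mul_nonneg (sub_nonneg.2 hx) (sub_nonneg.2 hy1),
    mul_nonneg (sub_nonneg.2 hy) (sub_nonneg.2 hx1)]

/-- `σ_x + σ_y - σ_xσ_y` is measurable. [folklore] -/
theorem measurable_spinAt_add_sub_mul (x y : V) :
    Measurable fun σ : SpinConfig V => spinAt x σ + spinAt y σ - spinAt x σ * spinAt y σ :=
  ((measurable_spinAt x).add (measurable_spinAt y)).sub
    ((measurable_spinAt x).mul (measurable_spinAt y))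

/-- The expectation of `σ_x + σ_y - σ_xσ_y` (`x ≠ y`) under a finite measure is
`⟨σ_x⟩ + ⟨σ_y⟩ - ⟨σ_xσ_y⟩` in terms of `spinCorr`. [folklore] -/
theorem integral_spinAt_add_sub_mul [DecidableEq V] (μ : Measure (SpinConfig V)) [IsFiniteMeasure μ]
    {x y : V} (hxy : x ≠ y) :
    ∫ σ, (spinAt x σ + spinAt y σ - spinAt x σ * spinAt y σ) ∂μ =
      spinCorr μ {x} + spinCorr μ {y} - spinCorr μ {x, y} := by
  have hpair : spinProduct ({x, y} : Finset V) = fun σ => spinAt x σ * spinAt y σ := by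
    funext σ
    rw [spinProduct, Finset.prod_pair hxy]
  have hix : Integrable (spinAt x) μ := by simpa using integrable_spinProduct μ {x}
  have hiy : Integrable (spinAt y) μ := by simpa using integrable_spinProduct μ {y}
  have hixy : Integrable (fun σ => spinAt x σ * spinAt y σ) μ := by
    have := integrable_spinProduct μ ({x, y} : Finset V)
    rwa [hpair] at this
  have hadd : Integrable (fun σ => spinAt x σ + spinAt y σ) μ := hix.add hiy
  simp only [spinCorr, spinProduct_singleton, hpair]
  rw [integral_sub hadd hixy, integral_add hix hiy]

end Observable

/-! ### The finite-volume FKG bound for a Gibbs state -/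

section Sandwich

variable {V : Type*} (G : SimpleGraph V) [DecidableEq V] [G.LocallyFinite] [Countable V]

/-- **`⟨σ_x⟩_ν + ⟨σ_y⟩_ν - ⟨σ_xσ_y⟩_ν ≤ ⟨σ_x⟩⁺_Λ + ⟨σ_y⟩⁺_Λ - ⟨σ_xσ_y⟩⁺_Λ` for every Gibbs state `ν`
and every finite `Λ`**: the DLR–FKG sandwich `ν(g) ≤ μ⁺_{Λ;β,h}(g)` (Friedli–Velenik 2017, proof
of Lemma 6.65, the display before (6.70); tree: `integral_le_isingExpect_plus_of_isGibbsMeasure`)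
for the nondecreasing observable `g = σ_x + σ_y - σ_xσ_y` of Exercise 3.10 / proof of Thm. 3.28.
Ising model on a locally finite graph with countably many vertices, `β ≥ 0`, any field `h`,
`x ≠ y`. [cite: FriedliVelenik2017, Thm. 3.28 (proof) and Lemma 6.65 (proof, eq. (6.70))] -/
theorem spinCorr_add_sub_pair_le_isingCorr_plus {β : ℝ} (hβ : 0 ≤ β) (h : ℝ)
    {ν : Measure (SpinConfig V)} (hν : IsGibbsMeasure (isingSpecification G β h) ν)
    (Λ : Finset V) {x y : V} (hxy : x ≠ y) :
    spinCorr ν {x} + spinCorr ν {y} - spinCorr ν {x, y} ≤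
      isingCorr G Λ β h .plus {x} + isingCorr G Λ β h .plus {y} - isingCorr G Λ β h .plus {x, y} := by
  haveI := hν.isProbabilityMeasure
  have key := integral_le_isingExpect_plus_of_isGibbsMeasure G hβ h hν Λ
    (monotone_spinAt_add_sub_mul x y) (measurable_spinAt_add_sub_mul x y)
  rw [integral_spinAt_add_sub_mul ν hxy] at key
  have hrhs : isingExpect G Λ β h .plus
      (fun σ : SpinConfig V => spinAt x σ + spinAt y σ - spinAt x σ * spinAt y σ) =
      isingCorr G Λ β h .plus {x} + isingCorr G Λ β h .plus {y} - isingCorr G Λ β h .plus {x, y} := by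
    simp only [isingCorr_eq_spinCorr]
    exact integral_spinAt_add_sub_mul (isingMeasure G Λ β h .plus) hxy
  rwa [hrhs] at key

end Sandwich

/-! ### On `ℤ^d`: the plus state against its finite-volume approximations -/

variable {d : ℕ}

/-- **`2 m*(β) - ⟨σ_xσ_y⟩⁺_{β,0} ≤ ⟨σ_x⟩⁺_{Λ;β,0} + ⟨σ_y⟩⁺_{Λ;β,0} - ⟨σ_xσ_y⟩⁺_{Λ;β,0}`** for the
nearest-neighbour Ising model on `ℤ^d` at zero field, `β ≥ 0`, `x ≠ y`, every finite `Λ`: the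
previous bound for the plus state `ν = μ⁺_{β,0} ∈ 𝒢(β,0)` (`exists_plusMeasure_holds`), whose
one-point function is `m*(β)` at every site (`plusCorr_singleton_eq_spontaneousMagnetization`).
This is the inequality "`∑_{i∈A}(⟨n_i⟩⁺ - ⟨n_i⟩) ≥ ⟨n_A⟩⁺ - ⟨n_A⟩`" of the proof of
Friedli–Velenik 2017, Thm. 3.28, for `A = {x,y}`, between `μ⁺_β` and `μ⁺_{Λ;β}`. [cite: FriedliVelenik2017, Thm. 3.28 (proof), p. 117] -/
theorem two_mul_spontaneousMagnetization_sub_plusCorr_le {β : ℝ} (hβ : 0 ≤ β)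
    (Λ : Finset (Site d)) {x y : Site d} (hxy : x ≠ y) :
    2 * spontaneousMagnetization d β - plusCorr d β 0 {x, y} ≤
      isingCorr (zdGraph d) Λ β 0 .plus {x} + isingCorr (zdGraph d) Λ β 0 .plus {y} -
        isingCorr (zdGraph d) Λ β 0 .plus {x, y} := by
  obtain ⟨μ, hμG, -, hcorr⟩ := exists_plusMeasure_holds (d := d) (β := β) (h := (0 : ℝ)) hβ
  have hν : IsGibbsMeasure (isingSpecification (zdGraph d) β 0) μ :=
    (mem_isingGibbsMeasures_iff d β 0 μ).1 hμG
  have key := spinCorr_add_sub_pair_le_isingCorr_plus (zdGraph d) hβ 0 hν Λ hxy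
  rw [hcorr, hcorr, hcorr, plusCorr_singleton_eq_spontaneousMagnetization hβ x,
    plusCorr_singleton_eq_spontaneousMagnetization hβ y] at key
  linarith

/-- `eᵢ ≠ 0` in `ℤ^d`. [folklore] -/
theorem zero_ne_single (i : Fin d) : (0 : Site d) ≠ Pi.single i 1 := by
  intro h0
  have := congrFun h0 i
  simp at this

/-! ### Lebowitz 1977, Remark (iii): left-continuity of `m*` at `β` gives `⟨σ_0σ_{eᵢ}⟩^∅_β = ⟨σ_0σ_{eᵢ}⟩⁺_β` -/

/-- **Continuity of the spontaneous magnetisation from the left at `β` implies equality of the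
free and plus nearest-neighbour energies at `β`** (Lebowitz 1977, Thm. 3 with Remark (iii),
p. 472, in the form quoted by Bodineau 2006, §1 p. 154 / §2.3 p. 156, and by Friedli–Velenik
2017, note [11] to p. 335: "continuity of the magnetization implies differentiability of the
pressure with respect to `β`"). For the nearest-neighbour Ising model on `ℤ^d` at zero field and
`β > 0`: if `β' ↦ m*(β')` is continuous within `(-∞, β)` at `β`, then
`⟨σ_0σ_{eᵢ}⟩^∅_{β,0} = ⟨σ_0σ_{eᵢ}⟩⁺_{β,0}` for every `i`. Proof: sum
`two_mul_spontaneousMagnetization_sub_plusCorr_le` at `β' < β` over the directions, bound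
`∑ᵢ ⟨σ_0σ_{eᵢ}⟩⁺_{β'}` by `∑ᵢ ⟨σ_0σ_{eᵢ}⟩^∅_β` (chord inequality of the convex pressure,
`sum_plusCorr_nn_le_sum_freeCorr_nn`), let `β' ↑ β` (finite-volume correlations are continuous in
`β`), then `Λ ↑ ℤ^d`; finally `⟨·⟩^∅ ≤ ⟨·⟩⁺` termwise. [cite: Lebowitz1977, §3, Thm. 3 and Remark (iii), p. 472] -/
theorem nn_freeCorr_eq_plusCorr_of_leftContinuous_magnetization {β : ℝ} (hβ : 0 < β)
    (hm : ContinuousWithinAt (spontaneousMagnetization d) (Set.Iio β) β) :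
    ∀ i : Fin d, freeCorr d β 0 {0, Pi.single i 1} = plusCorr d β 0 {0, Pi.single i 1} := by
  set m : ℝ → ℝ := spontaneousMagnetization d with hmdef
  set F : ℝ := ∑ i : Fin d, freeCorr d β 0 {0, Pi.single i 1} with hF
  -- the finite-volume right-hand side, continuous in `b`
  set R : ℕ → ℝ → ℝ := fun L b => ∑ i : Fin d,
      (isingCorr (zdGraph d) (box d L) b 0 .plus {0} +
        isingCorr (zdGraph d) (box d L) b 0 .plus {Pi.single i 1} -
          isingCorr (zdGraph d) (box d L) b 0 .plus {0, Pi.single i 1}) with hR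
  have hRcont : ∀ L : ℕ, Continuous (R L) := fun L =>
    continuous_finsetSum _ fun i _ =>
      ((continuous_isingCorr_beta (zdGraph d) (box d L) 0 .plus {0}).add
        (continuous_isingCorr_beta (zdGraph d) (box d L) 0 .plus {Pi.single i 1})).sub
        (continuous_isingCorr_beta (zdGraph d) (box d L) 0 .plus {0, Pi.single i 1})
  -- Step A: for `0 ≤ b < β` and every box, `2 d m(b) - R_L(b) ≤ F`
  have hA : ∀ L : ℕ, ∀ b : ℝ, 0 ≤ b → b < β → 2 * (d : ℝ) * m b - R L b ≤ F := by
    intro L b hb0 hbβ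
    have h1 : ∑ i : Fin d, (2 * m b - plusCorr d b 0 {0, Pi.single i 1}) ≤ R L b :=
      Finset.sum_le_sum fun i _ =>
        two_mul_spontaneousMagnetization_sub_plusCorr_le hb0 (box d L) (zero_ne_single i)
    have h2 : ∑ i : Fin d, plusCorr d b 0 {0, Pi.single i 1} ≤ F :=
      sum_plusCorr_nn_le_sum_freeCorr_nn hb0 hbβ
    rw [Finset.sum_sub_distrib, Finset.sum_const, Finset.card_univ, Fintype.card_fin,
      nsmul_eq_mul] at h1
    linarith
  -- Step B: `β' ↑ β`, using the left-continuity of `m*` and the continuity of `R_L`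
  have hB : ∀ L : ℕ, 2 * (d : ℝ) * m β - R L β ≤ F := by
    intro L
    have hcont : ContinuousWithinAt (fun b : ℝ => 2 * (d : ℝ) * m b - R L b) (Set.Iio β) β :=
      (continuousWithinAt_const.mul hm).sub (hRcont L).continuousWithinAt
    have hev : ∀ᶠ b in 𝓝[<] β, 2 * (d : ℝ) * m b - R L b ≤ F := by
      filter_upwards [Ioo_mem_nhdsLT hβ] with b hb
      exact hA L b hb.1.le hb.2
    exact le_of_tendsto hcont.tendsto hev
  -- Step C: `Λ ↑ ℤ^d`, `R_L(β) → ∑ᵢ (2 m(β) - ⟨σ_0σ_{eᵢ}⟩⁺_β)`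
  have hC : Tendsto (fun L : ℕ => R L β) atTop
      (𝓝 (∑ i : Fin d, (m β + m β - plusCorr d β 0 {0, Pi.single i 1}))) := by
    refine tendsto_finsetSum _ fun i _ => ?_
    refine Tendsto.sub (Tendsto.add ?_ ?_) (tendsto_isingCorr_plus_box hβ.le 0 {0, Pi.single i 1})
    · have h0 := tendsto_isingCorr_plus_box (d := d) hβ.le 0 ({0} : Finset (Site d))
      rwa [plusCorr_singleton_eq_spontaneousMagnetization hβ.le] at h0
    · have h1 := tendsto_isingCorr_plus_box (d := d) hβ.le 0 ({Pi.single i 1} : Finset (Site d))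
      rwa [plusCorr_singleton_eq_spontaneousMagnetization hβ.le] at h1
  have hD : 2 * (d : ℝ) * m β - ∑ i : Fin d, (m β + m β - plusCorr d β 0 {0, Pi.single i 1}) ≤ F :=
    le_of_tendsto (tendsto_const_nhds.sub hC) (Eventually.of_forall hB)
  have hPF : ∑ i : Fin d, plusCorr d β 0 {0, Pi.single i 1} ≤ F := by
    rw [Finset.sum_sub_distrib, Finset.sum_const, Finset.card_univ, Fintype.card_fin,
      nsmul_eq_mul] at hD
    linarith
  -- termwise `⟨·⟩^∅ ≤ ⟨·⟩⁺`
  have hterm : ∀ i ∈ (univ : Finset (Fin d)),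
      0 ≤ plusCorr d β 0 {0, Pi.single i 1} - freeCorr d β 0 {0, Pi.single i 1} :=
    fun i _ => sub_nonneg.2 (freeCorr_le_plusCorr hβ.le le_rfl _)
  have hsum0 : ∑ i, (plusCorr d β 0 {0, Pi.single i 1} - freeCorr d β 0 {0, Pi.single i 1}) = 0 := by
    apply le_antisymm
    · rw [Finset.sum_sub_distrib]
      linarith
    · exact Finset.sum_nonneg hterm
  intro i
  have := (Finset.sum_eq_zero_iff_of_nonneg hterm).1 hsum0 i (mem_univ i)
  linarith

/-- The same with the (stronger) hypothesis of two-sided continuity of `m*` at `β`. [cite: Lebowitz1977, §3, Thm. 3 and Remark (iii), p. 472] -/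
theorem nn_freeCorr_eq_plusCorr_of_continuousAt_magnetization {β : ℝ} (hβ : 0 < β)
    (hm : ContinuousAt (spontaneousMagnetization d) β) :
    ∀ i : Fin d, freeCorr d β 0 {0, Pi.single i 1} = plusCorr d β 0 {0, Pi.single i 1} :=
  nn_freeCorr_eq_plusCorr_of_leftContinuous_magnetization hβ hm.continuousWithinAt

/-! ### Consequences: mixtures, and Bodineau's theorem from the continuity of `m*` -/

/-- **Lebowitz 1977, Thm. 3 with Remark (iii), p. 472, magnetisation form (as used by Bodineau
2006, §2.3): at every `β > β_c(d)` at which `m*` is continuous from the left, the translation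
invariant Gibbs states of the zero-field nearest-neighbour Ising model on `ℤ^d`, `d ≥ 2`, are
the mixtures `t μ⁺ + (1-t) μ⁻`** (with `μ± ∈ 𝒢(β,0)` the states of correlations `plusCorr`,
`minusCorr`). From `nn_freeCorr_eq_plusCorr_of_leftContinuous_magnetization` and the tree's
Lebowitz theorem `translationInvariant_eq_mixture_of_nn_freeCorr_eq_plusCorr`; `d ≥ 2` gives
`β_c(d) > 0` and `m*(β) > 0` (Peierls). [cite: Lebowitz1977, §3, Thm. 3 and Remark (iii), p. 472] -/
theorem translationInvariant_eq_mixture_of_leftContinuous_magnetization (hd : 2 ≤ d) {β : ℝ}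
    (hβc : criticalBeta d < β)
    (hm : ContinuousWithinAt (spontaneousMagnetization d) (Set.Iio β) β)
    {μ : Measure (SpinConfig (Site d))} (hμG : μ ∈ isingGibbsMeasures d β 0)
    (hμT : IsTranslationInvariantMeasure μ) :
    ∃ μp μm : Measure (SpinConfig (Site d)),
      μp ∈ isingGibbsMeasures d β 0 ∧ μm ∈ isingGibbsMeasures d β 0 ∧
        (∀ A, spinCorr μp A = plusCorr d β 0 A) ∧ (∀ A, spinCorr μm A = minusCorr d β 0 A) ∧
          ∃ t : ℝ≥0∞, t ≤ 1 ∧ μ = t • μp + (1 - t) • μm := by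
  have hβ : 0 < β := (criticalBeta_pos_holds hd).trans hβc
  exact translationInvariant_eq_mixture_of_nn_freeCorr_eq_plusCorr hβ
    (spontaneousMagnetization_pos_of_criticalBeta_lt_holds hd hβc)
    (nn_freeCorr_eq_plusCorr_of_leftContinuous_magnetization hβ hm) hμG hμT

/-- **Bodineau's theorem at `(d, β)` from the left-continuity of the spontaneous magnetisation
at `β`** — the route of Bodineau 2006 itself (§1, p. 154 and §2.3, p. 156: Thm. 2.1 gives the
continuity of `β ↦ m*(β)` on `(β_c, ∞)`, and "the continuity of the average magnetization
implies the existence of only two extremal invariant states" by Lebowitz 1977, Thm. 3 and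
Remark (iii)): the named fact `bodineau_translationInvariant` (`GibbsStates.lean`) holds at
`(d, β)` as soon as `m*` is continuous from the left at `β` whenever `β > β_c(d)`. The remaining
input — left-continuity of `m*` on `(β_c(d), ∞)` for `d ≥ 3` (Bodineau 2006; Raoufi 2020,
Cor. 1) — is not in the tree. [cite: Bodineau2006, §1 p. 154 and §2.3 p. 156] -/
theorem bodineau_translationInvariant_of_leftContinuous_magnetization {β : ℝ}
    (hm : criticalBeta d < β → ContinuousWithinAt (spontaneousMagnetization d) (Set.Iio β) β) :
    bodineau_translationInvariant (d := d) (β := β) := by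
  intro hd hβc μ hμ hμT
  have hd2 : 2 ≤ d := le_trans (by norm_num) hd
  obtain ⟨μp, μm, hμp, hμm, hp, hmc, t, ht, hμeq⟩ :=
    translationInvariant_eq_mixture_of_leftContinuous_magnetization hd2 hβc (hm hβc) hμ hμT
  exact ⟨μp, μm, hμp, hμm, hp, hmc, t, ht, hμeq⟩

/-- The same from two-sided continuity of `m*` at `β` (the form "`β ↦ ⟨σ_0⟩⁺_β` is continuous
everywhere except possibly at `β_c`", Raoufi 2020, Cor. 1; Bodineau 2006, §1). [cite: Bodineau2006, §1 p. 154 and §2.3 p. 156] -/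
theorem bodineau_translationInvariant_of_continuousAt_magnetization {β : ℝ}
    (hm : criticalBeta d < β → ContinuousAt (spontaneousMagnetization d) β) :
    bodineau_translationInvariant (d := d) (β := β) :=
  bodineau_translationInvariant_of_leftContinuous_magnetization fun hβc =>
    (hm hβc).continuousWithinAt

end Literature.Probability.LatticeModels
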